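import Mathlib
import Literature.Computability.AlgebraicComplexity.PrattTrapezoidVal
import Literature.Computability.AlgebraicComplexity.PrattTrapezoidValBounds
import Literature.Computability.AlgebraicComplexity.LocalStrongUSP
import Summits.MatrixMultiplication.MatrixMultiplication.Theorems.SoloBlindPrattValCyclic

/-!
# A local strong USP of size 8 and width 8, and `Val(ℤ/nℤ) ≥ 3.19 · n` for an explicit `n`

Solo-blind line Q12 (Pratt, arXiv:2309.03878, `Val`), fifth file.  CKSU (2005, §6.1) local strong
USPs of width `k` and size `L` give simultaneous triple product configurations in `K₁ × ⋯ × K_k` of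
value `L · ∏ (|Kⱼ| − 1)` (tree: `soloVal_le_prattVal_pi_of_isLocalStrongUSP`, mixed coordinates), hence
`L · ∏ⱼ (mⱼ − 1) ≤ Val(ℤ/nℤ)` for pairwise coprime moduli with product `n`
(`soloVal_le_prattVal_zmod_of_isLocalStrongUSP`).  The earlier files used the width-3 puzzle
`{123, 231}` (`L = 2`, per-coordinate rate `2^{1/3} ≈ 1.26`).  A SAT search (kissat; this seat's
`lsusp_sat.py`) found that the maximum size of a local strong USP of width `k` is `1, 1, 2, 2, 3, 4`
for `k = 1, …, 6`, is `≥ 6` for `k = 7` and `≥ 8` for `k = 8`; the width-8, size-8 puzzle below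
(per-coordinate rate `8^{1/8} ≈ 1.297`) is kernel-verified here (`decide`) and yields, e.g.,
`Val(ℤ/116396280ℤ) ≥ 371589120 > 3.19 · 116396280` (moduli `5,7,8,9,11,13,17,19`) and the general
block inequality `8 · ∏ⱼ (mⱼ − 1) ≤ Val(ℤ/(∏ⱼ mⱼ)ℤ)` for eight pairwise coprime moduli, whence
`Val(ℤ/nℤ) ≥ 7n` whenever `n` is a product of eight pairwise coprime numbers `≥ 64`.  The width-7,
size-6 puzzle is recorded as well.
-/

set_option linter.dupNamespace false
set_option maxRecDepth 4000

namespace Summit.MatrixMultiplication.MatrixMultiplication.Theorems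

open Finset Literature.Computability.AlgebraicComplexity

/-- The width-8 local strong USP of size 8 found by SAT search (symbols `1,2,3` coded `0,1,2`):
`33322211, 33132221, 31332212, 31123322, 13323212, 13322321, 13132322, 11333222`. -/
theorem soloVal_isLocalStrongUSP_width8 :
    IsLocalStrongUSP
      ![![(2 : Fin 3), 2, 2, 1, 1, 1, 0, 0],
      ![(2 : Fin 3), 2, 0, 2, 1, 1, 1, 0],
      ![(2 : Fin 3), 0, 2, 2, 1, 1, 0, 1],
      ![(2 : Fin 3), 0, 0, 1, 2, 2, 1, 1],
      ![(0 : Fin 3), 2, 2, 1, 2, 1, 0, 1],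
      ![(0 : Fin 3), 2, 2, 1, 1, 2, 1, 0],
      ![(0 : Fin 3), 2, 0, 2, 1, 2, 1, 1],
      ![(0 : Fin 3), 0, 2, 2, 2, 1, 1, 1]] := by
  unfold IsLocalStrongUSP localStrongUSPPatterns
  decide

/-- **Eight-modulus block.**  For pairwise coprime moduli `m₀, …, m₇ ≥ 1` with product `n`:
`8 · ∏ⱼ (mⱼ − 1) ≤ Val(ℤ/nℤ)`. -/
theorem soloVal_eightBlock (m : Fin 8 → ℕ) (hm0 : ∀ j, m j ≠ 0)
    (hm : Pairwise (Function.onFun Nat.Coprime m)) (n : ℕ) [NeZero n] (hn : n = ∏ j, m j) :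
    8 * ∏ j, (m j - 1) ≤ prattVal (ZMod n) :=
  soloVal_le_prattVal_zmod_of_isLocalStrongUSP soloVal_isLocalStrongUSP_width8 m hm0 hm n hn

/-- **`Val(ℤ/116396280ℤ) ≥ 371589120`** (`> 3.19 · 116396280`; moduli `5, 7, 8, 9, 11, 13, 17, 19`,
value `8 · 4·6·7·8·10·12·16·18`). -/
theorem soloVal_prattVal_zmod116396280 : 371589120 ≤ prattVal (ZMod 116396280) := by
  have hm : Pairwise (Function.onFun Nat.Coprime ![5, 7, 8, 9, 11, 13, 17, 19]) := by
    unfold Pairwise; decide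
  have h := soloVal_eightBlock ![5, 7, 8, 9, 11, 13, 17, 19] (by decide) hm 116396280 (by decide)
  have h8 : ∏ j : Fin 8, (![5, 7, 8, 9, 11, 13, 17, 19] j - 1) = 46448640 := by decide
  rw [h8] at h
  omega

/-- `Val(ℤ/nℤ) > 3 · n` for `n = 116396280`. -/
theorem soloVal_three_mul_card_lt_prattVal :
    3 * Fintype.card (ZMod 116396280) < prattVal (ZMod 116396280) := by
  rw [ZMod.card]
  exact lt_of_lt_of_le (by norm_num) soloVal_prattVal_zmod116396280

/-- A width-7 local strong USP of size 6 (SAT search; symbols `1,2,3` coded `0,1,2`):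
`3332211, 3322131, 3233112, 3123231, 1333212, 1323132`.  (Size 5 at width 6 does not exist —
SAT certificate, not formalised.) -/
theorem soloVal_isLocalStrongUSP_width7 :
    IsLocalStrongUSP
      ![![(2 : Fin 3), 2, 2, 1, 1, 0, 0],
      ![(2 : Fin 3), 2, 1, 1, 0, 2, 0],
      ![(2 : Fin 3), 1, 2, 2, 0, 0, 1],
      ![(2 : Fin 3), 0, 1, 2, 1, 2, 0],
      ![(0 : Fin 3), 2, 2, 2, 1, 0, 1],
      ![(0 : Fin 3), 2, 1, 2, 0, 2, 1]] := by
  unfold IsLocalStrongUSP localStrongUSPPatterns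
  decide

/-- **Eight coprime moduli `≥ 64` give `Val(ℤ/nℤ) ≥ 7n`** (`8 · (63/64)^8 > 7`). -/
theorem soloVal_eightBlock_ge64 (m : Fin 8 → ℕ) (h64 : ∀ j, 64 ≤ m j)
    (hm : Pairwise (Function.onFun Nat.Coprime m)) (n : ℕ) [NeZero n] (hn : n = ∏ j, m j) :
    7 * n ≤ prattVal (ZMod n) := by
  have h := soloVal_eightBlock m (fun j => by have := h64 j; omega) hm n hn
  have hprod : ∏ j, (63 * m j) ≤ ∏ j, (64 * (m j - 1)) :=
    Finset.prod_le_prod' fun j _ => by have := h64 j; omega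
  rw [Finset.prod_mul_distrib, Finset.prod_mul_distrib, Finset.prod_const, Finset.prod_const,
    Finset.card_univ, Fintype.card_fin, ← hn] at hprod
  obtain ⟨P, hP⟩ : ∃ P, ∏ j, (m j - 1) = P := ⟨_, rfl⟩
  rw [hP] at h hprod
  norm_num at hprod
  omega

end Summit.MatrixMultiplication.MatrixMultiplication.Theorems
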